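import Literature.AlgebraicGeometry.AbelianSchemes.AbelianSchemeFibreHomBaseChangeId
import HarnessLib

/-!
# The fibre of the restricted family `A ×_S S'` WITH ITS STRUCTURES: naturality of `((A ×_S S')_t) ≅ A_{t ≫ g}` in the
# abelian scheme ([MumfordFogartyKirwan1994] Ch. 7 §2 Def. 7.2 «`(X, λ, σᵢ) ↦ (X ×_S T, λ_T, σᵢ ×_S T)`»; [GortzWedhorn2020] (4.7))

Topic `AlgebraicGeometry/AbelianSchemes`; namespace `Literature.AlgebraicGeometry.AbelianSchemes.AbelianSchemeOver`.
KERNEL ONLY: theorems; **no definition, no named fact, no instance, no notation, no `sorry`**.  Cell `pub/hodgecm-mathlib`,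
programme P6 («MOD»), piece (d4) of the (d1)/(d2) lineage: (d1) ★ `AbelianSchemeFibreFrobeniusTwist` (the Frobenius-moved
fibre), (d2) ★ `AbelianSchemeFibreFrobeniusTwistHom` (its homomorphism squares, and those of ★ `conjFibreIso`,
★ `fibreCongrPtIso`); this file is the BASE-CHANGE sibling: the homomorphism square of ★ `fibreBaseChangeIso`
(`((A ×_S S')_t) ≅ A_{t ≫ g}`, B-p02/B-p13), whose section junction is ★ `map_fibreBaseChangeIso_restrictPt_sectionBaseChange`.

## Mathematics

Let `A, B` be abelian schemes over `S`, `f : A → B` a homomorphism of `S`-group schemes, `g : S' → S`, and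
`t : Spec Ω → S'` a field-valued point.  Base change along `g` gives the restricted families `A ×_S S'`, `B ×_S S'` and the
homomorphism `f ×_S S'` (★ `baseChangeHom`, a homomorphism by ★ `isMonHom_baseChangeHom`); the fibre identification
`e_A : (A ×_S S')_t ≅ A_{t ≫ g}` is the component at `A` of Mathlib's natural isomorphism
`Over.pullbackComp t g : Over.pullback (t ≫ g) ≅ Over.pullback g ⋙ Over.pullback t` lifted to group objects
(★ `baseChangeCompGrpIso`), hence NATURAL IN THE ABELIAN SCHEME:
**`(f ×_S S')_t ≫ e_B = e_A ≫ f_{t ≫ g}`** (§1).  With the section junction this says that the moduli tuple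
`(A ×_S S', ι ×_S S', λ ×_S S', η ×_S S')` read at `t` IS the tuple `(A, ι, λ, η)` read at `t ≫ g` — Mumford's
functoriality «`(X, λ, σᵢ) ↦ (X ×_S T, λ_T, σᵢ ×_S T)`» of the moduli problem on geometric fibres.

USE (P6 HEART, DICT (c2)(c3a)).  The universal tuple `(𝒜, ι, λ, η) → 𝓜` is read on the restricted families
`𝒜|_{𝓜 ⊗ 𝒪_(w)}`, `𝒜|_{special fibre}` (a `κ(w)`-scheme, where ★ (d1)(d2) apply) and `𝒜|_{Spec 𝒪_Ω̄}` (integral points);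
this file + ★ (d2) close the fibre-tuple bookkeeping under base change ∕ equality of points ∕ conjugation ∕ Frobenius.

## Contents
* §1 **`fibreHom_baseChangeHom_comp_fibreBaseChangeIso_hom`** (the square), `baseChangeHom_fibreHom_comp_fibreBaseChangeIso_inv`
  (inverse form), `fibreHom_baseChangeHom_eq_conj` (endomorphism form, for `ι(a)`), `map_fibreBaseChangeIso_map_fibreHom_baseChangeHom`
  (points form);
* §2 `exists_iso_fibre_baseChange_natural` — def-free packaging: ONE family `e_A`, natural in `A` (hom squares) AND carrying
  `(τ ×_S S')(t)` to `τ(t ≫ g)` (★ section junction).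

HC_CM is proved only modulo the printed citations until rung 0 closes; this file changes no count.

## References
* [MumfordFogartyKirwan1994] D. Mumford, J. Fogarty, F. Kirwan, *Geometric Invariant Theory*, 3rd ed. (1994), Ch. 6 §2
  Def. 6.3 (p. 120) (the induced `λ̄` on geometric fibres), Ch. 7 §2 Def. 7.2 (p. 129) (base change of the moduli datum).
* [GortzWedhorn2020] U. Görtz, T. Wedhorn, *Algebraic Geometry I*, 2nd ed. (2020), Section (4.7) (p. 135) (transitivity of
  base change), Remark 16.54 (base change of group schemes).
-/

set_option autoImplicit false

noncomputable section

universe u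

open CategoryTheory CategoryTheory.Limits AlgebraicGeometry

namespace Literature.AlgebraicGeometry.AbelianSchemes

namespace AbelianSchemeOver

open Literature.AlgebraicGeometry.Motives
open scoped MonObj

variable {S S' : Scheme.{u}} {A B : AbelianSchemeOver S} (g : S' ⟶ S) {Ω : Type u} [Field Ω]
  (t : Spec (.of Ω) ⟶ S')

/-! ## §1 Naturality of `fibreBaseChangeIso` in the abelian scheme -/

/-- The underlying `Ω`-morphism of `fibreBaseChangeIso` is the component at `A` of the inverse of Mathlib's
`Over.pullbackComp t g` (★ `baseChangeCompGrpIso_inv_hom_hom`). [cite: GortzWedhorn2020, Section (4.7) (p. 135)] -/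
theorem fibreBaseChangeIso_hom_hom_hom_hom (A : AbelianSchemeOver S) :
    (A.fibreBaseChangeIso g t).hom.hom.hom.hom = (Over.pullbackComp t g).inv.app A.X := by
  change (A.baseChangeCompGrpIso g t).inv.hom.hom = _
  exact A.baseChangeCompGrpIso_inv_hom_hom g t

/-- **Naturality of `fibreBaseChangeIso` in the abelian scheme — Mumford's «`(X, λ, σᵢ) ↦ (X ×_S T, λ_T, σᵢ ×_S T)`» read
on geometric fibres.**  For a homomorphism `f : A → B` of abelian schemes over `S` (e.g. `ι(a)`, or a polarisation
`λ : A → Â` with `B = D.hat`), the fibre at `t` of its base change `f ×_S S'` (★ `baseChangeHom`) and its fibre at `t ≫ g`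
correspond under `(A ×_S S')_t ≅ A_{t ≫ g}`, `(B ×_S S')_t ≅ B_{t ≫ g}`: `(f ×_S S')_t ≫ e_B = e_A ≫ f_{t ≫ g}` (both are
images of `f` under the two functors of Mathlib's `Over.pullbackComp t g`; naturality of its inverse).
[cite: MumfordFogartyKirwan1994, Ch. 7 §2 Definition 7.2 (p. 129)] [cite: GortzWedhorn2020, Section (4.7) (p. 135) and Remark 16.54] -/
theorem fibreHom_baseChangeHom_comp_fibreBaseChangeIso_hom (f : A.X ⟶ B.X) [IsMonHom f] :
    haveI := isMonHom_baseChangeHom f g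
    fibreHom (baseChangeHom f g) t ≫ (B.fibreBaseChangeIso g t).hom =
      (A.fibreBaseChangeIso g t).hom ≫ fibreHom f (t ≫ g) := by
  haveI := isMonHom_baseChangeHom f g
  apply AbelianVariety.hom_ext
  change (fibreHom (baseChangeHom f g) t).hom.hom.hom ≫ (B.fibreBaseChangeIso g t).hom.hom.hom.hom =
    (A.fibreBaseChangeIso g t).hom.hom.hom.hom ≫ (fibreHom f (t ≫ g)).hom.hom.hom
  rw [fibreBaseChangeIso_hom_hom_hom_hom, fibreBaseChangeIso_hom_hom_hom_hom, fibreHom_hom_hom_hom,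
    fibreHom_hom_hom_hom]
  exact (Over.pullbackComp t g).inv.naturality f

/-- Inverse form: `f_{t ≫ g} ≫ e_B⁻¹ = e_A⁻¹ ≫ (f ×_S S')_t`. [cite: MumfordFogartyKirwan1994, Ch. 7 §2 Definition 7.2 (p. 129)] -/
theorem fibreHom_comp_fibreBaseChangeIso_inv (f : A.X ⟶ B.X) [IsMonHom f] :
    haveI := isMonHom_baseChangeHom f g
    fibreHom f (t ≫ g) ≫ (B.fibreBaseChangeIso g t).inv =
      (A.fibreBaseChangeIso g t).inv ≫ fibreHom (baseChangeHom f g) t := by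
  haveI := isMonHom_baseChangeHom f g
  rw [Iso.comp_inv_eq, Category.assoc, Iso.eq_inv_comp, fibreHom_baseChangeHom_comp_fibreBaseChangeIso_hom]

/-- **Endomorphism form** (the structure `ι ×_S S'` read at `t`): for an endomorphism `k` of the abelian scheme `A` (e.g.
`k = ι(a)` of an `𝒪`-action), `(k ×_S S')_t = e_A ≫ k_{t ≫ g} ≫ e_A⁻¹`. [cite: MumfordFogartyKirwan1994, Ch. 7 §2 Definition 7.2 (p. 129)] -/
theorem fibreHom_baseChangeHom_eq_conj (k : A.X ⟶ A.X) [IsMonHom k] :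
    haveI := isMonHom_baseChangeHom k g
    fibreHom (baseChangeHom k g) t =
      (A.fibreBaseChangeIso g t).hom ≫ fibreHom k (t ≫ g) ≫ (A.fibreBaseChangeIso g t).inv := by
  haveI := isMonHom_baseChangeHom k g
  rw [← Category.assoc, Iso.eq_comp_inv, fibreHom_baseChangeHom_comp_fibreBaseChangeIso_hom]

/-- **Points form**: for an `L`-valued point `Q` of `(A ×_S S')_t` (`L` any field over `Ω`),
`e_B((f ×_S S')_t(Q)) = f_{t ≫ g}(e_A(Q))`. [cite: MumfordFogartyKirwan1994, Ch. 6 §2 Definition 6.3 (p. 120)] -/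
theorem map_fibreBaseChangeIso_map_fibreHom_baseChangeHom (f : A.X ⟶ B.X) [IsMonHom f] {L : Type u} [Field L]
    [Algebra Ω L] (Q : AlgPoints ((A.baseChange g).fibre t).toAbelianVariety.X L) :
    haveI := isMonHom_baseChangeHom f g
    AlgPoints.map (B.fibreBaseChangeIso g t).hom.hom.hom.hom (AlgPoints.map (fibreHom (baseChangeHom f g) t).hom.hom.hom Q) =
      AlgPoints.map (fibreHom f (t ≫ g)).hom.hom.hom (AlgPoints.map (A.fibreBaseChangeIso g t).hom.hom.hom.hom Q) := by
  haveI := isMonHom_baseChangeHom f g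
  change (Q ≫ (fibreHom (baseChangeHom f g) t).hom.hom.hom) ≫ (B.fibreBaseChangeIso g t).hom.hom.hom.hom =
    (Q ≫ (A.fibreBaseChangeIso g t).hom.hom.hom.hom) ≫ (fibreHom f (t ≫ g)).hom.hom.hom
  have h := congrArg (fun φ => φ.hom.hom.hom) (fibreHom_baseChangeHom_comp_fibreBaseChangeIso_hom g t f)
  simp only [AbelianVariety.comp_hom] at h
  rw [Category.assoc, Category.assoc]
  exact congrArg (fun ψ => Q ≫ ψ) h

/-! ## §2 Def-free natural packaging -/

/-- **Def-free natural packaging for consumers**: there is ONE family of isomorphisms `e_A : (A ×_S S')_t ≅ A_{t ≫ g}`,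
indexed by the abelian schemes `A` over `S`, which (i) carries the value at `t` of every pulled-back section `τ ×_S S'`
(★ `sectionBaseChange`) to the value of `τ` at `t ≫ g` (★ `map_fibreBaseChangeIso_restrictPt_sectionBaseChange`) and
(ii) is natural in `A` for homomorphisms of abelian schemes: the tuple `(A ×_S S', ι ×_S S', λ ×_S S', η ×_S S')` at `t`
IS the tuple `(A, ι, λ, η)` at `t ≫ g`. [cite: MumfordFogartyKirwan1994, Ch. 7 §2 Definition 7.2 (p. 129)]
[cite: GortzWedhorn2020, Section (4.7) (p. 135)] -/
theorem exists_iso_fibre_baseChange_natural :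
    ∃ e : ∀ A : AbelianSchemeOver S, ((A.baseChange g).fibre t).toAbelianVariety ≅ (A.fibre (t ≫ g)).toAbelianVariety,
      (∀ (A : AbelianSchemeOver S) (τ : A.Sections),
          AlgPoints.map (e A).hom.hom.hom.hom ((A.baseChange g).restrictPt t (A.sectionBaseChange g τ)) =
            A.restrictPt (t ≫ g) τ) ∧
      ∀ (A B : AbelianSchemeOver S) (f : A.X ⟶ B.X) [IsMonHom f],
        (haveI := isMonHom_baseChangeHom f g
         fibreHom (baseChangeHom f g) t ≫ (e B).hom = (e A).hom ≫ fibreHom f (t ≫ g)) :=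
  ⟨fun A => A.fibreBaseChangeIso g t, fun A τ => A.map_fibreBaseChangeIso_restrictPt_sectionBaseChange g t τ,
    fun _ _ f _ => fibreHom_baseChangeHom_comp_fibreBaseChangeIso_hom g t f⟩

end AbelianSchemeOver

end Literature.AlgebraicGeometry.AbelianSchemes

end
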